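/-
Copyright (c) 2026. All rights reserved.
Released under Apache 2.0 license as described in the file LICENSE.
Authors: abc-iut cell, wave-2 seat abc-iut-L3-t11 (proof-only; row «(I4) PRODUCER REDUCTION», first two
pieces: the compact-intersection lemma and the consumer in a compact overgroup).
-/
import Literature.AnabelianGeometry.SemiGraphs.TemperedNoFixedBranchPair
import HarnessLib

/-!
# The estrangement step of [SemiAnbd] Thm 3.7 (iii) through a compact overgroup of `π₁^temp`

Mochizuki, *Semi-graphs of anabelioids*, Publ. RIMS **42** (2006) [MochizukiSemiAnbd2006], proof of Thm 3.7
(iii), p. 41, with the author's *Comments* (2020), (6)(b): the compatible system of `H`-fixed subjoints of the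
FINITE levels "converge[s], in the profinite topology, to some profinite subjoint" and "this implies [cf. Remark
2.2.1] that `H` is contained in some conjugate in the PROFINITE fundamental group `π̂₁(G)` of some `π̂₁(G_v)`,
and … in the intersection of the images of `π₁(G_e)`, `π₁(G_{e'})` via `b`, `b'`" — the identification happens
in the profinite completion, where compatible choices exist by compactness, not in `π₁^temp(G)` itself.

Accordingly this PROOF-ONLY file (a) generalises the consumer of `TemperedNoFixedBranchPair.lean` to an
identification (I4′) valued in an arbitrary COMPACT overgroup `ι : π₁^temp ↪ Q` — the pointwise stabiliser of a
compatible system of branch-pairs of the finite levels maps under `ι` into `ψ(x·Π_b·x⁻¹) ∩ ψ(x'·Π_{b'}·x'⁻¹)`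
for an injective `ψ : Π_v → Q` and two distinct branch-cosets — which again yields the hypothesis `hnobp` of
`SemiGraph.hstar_of_noFixedBranchPairSystem` (`noFixedBranchPairSystem_of_isTotallyEstranged'`); and (b)
proves the topological-group lemma by which "membership modulo every finite level" is upgraded to membership:
for `K` compact and a directed family of open subgroups `N_i` with `⋂ N_i = 1`, `⋂_i K·N_i = K`
(`iInter_mul_coe_eq_of_isCompact`). No definitions.
-/

namespace Literature.AnabelianGeometry.SemiGraphs

open CategoryTheory Topology
open scoped Pointwise

universe v u

/-! ### Compact sets are closed for the "finite-level" uniformity -/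

/-- **`⋂_i K·N_i = K`** for `K` compact and `(N_i)` a downward-directed family of open subgroups with trivial
intersection: if `g ∈ K·N_i` for every `i`, the sets `K ∩ g·N_i` are directed, nonempty and closed in the
compact `K`, so they have a common point `k`, and `k⁻¹g ∈ ⋂ N_i = {1}`.
[cite: MochizukiSemiAnbd2006, Thm. 3.7(iii) p.41] -/
theorem iInter_mul_coe_eq_of_isCompact {G : Type u} [Group G] [TopologicalSpace G] [IsTopologicalGroup G]
    [T2Space G] {ι : Type v} [Nonempty ι] (N : ι → Subgroup G) (hopen : ∀ i, IsOpen (N i : Set G))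
    (hdir : ∀ i j, ∃ k, N k ≤ N i ∧ N k ≤ N j) (hbot : ∀ g : G, (∀ i, g ∈ N i) → g = 1)
    {K : Set G} (hK : IsCompact K) :
    ⋂ i, K * (N i : Set G) = K := by
  apply Set.Subset.antisymm
  · intro g hg
    rw [Set.mem_iInter] at hg
    -- the closed sets `F i = K ∩ g·N_i`
    let F : ι → Set G := fun i => K ∩ (fun n : G => g * n) '' (N i : Set G)
    have hFclosed : ∀ i, IsClosed (F i) := by
      intro i
      refine hK.isClosed.inter ?_
      have : (fun n : G => g * n) '' (N i : Set G) = (fun y : G => g⁻¹ * y) ⁻¹' (N i : Set G) := by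
        ext y; constructor
        · rintro ⟨n, hn, rfl⟩; simpa using hn
        · intro hy; exact ⟨g⁻¹ * y, hy, by simp⟩
      rw [this]
      exact ((N i).isClosed_of_isOpen (hopen i)).preimage (continuous_const.mul continuous_id)
    have hFne : ∀ i, (F i).Nonempty := by
      intro i
      obtain ⟨k, hk, n, hn, hkn⟩ := Set.mem_mul.mp (hg i)
      refine ⟨k, hk, n⁻¹, (N i).inv_mem hn, ?_⟩
      show g * n⁻¹ = k
      rw [← hkn, mul_inv_cancel_right]
    have hFdir : Directed (· ⊇ ·) F := by
      intro i j
      obtain ⟨k, hki, hkj⟩ := hdir i j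
      refine ⟨k, ?_, ?_⟩
      · rintro y ⟨hyK, n, hn, rfl⟩; exact ⟨hyK, n, hki hn, rfl⟩
      · rintro y ⟨hyK, n, hn, rfl⟩; exact ⟨hyK, n, hkj hn, rfl⟩
    have hFsub : ∀ i, F i ⊆ K := fun i => Set.inter_subset_left
    -- a common point
    obtain ⟨k, hk⟩ := IsCompact.nonempty_iInter_of_directed_nonempty_isCompact_isClosed F hFdir hFne
      (fun i => hK.of_isClosed_subset (hFclosed i) (hFsub i)) hFclosed
    rw [Set.mem_iInter] at hk
    have hkK : k ∈ K := (hk (Classical.arbitrary ι)).1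
    have hgk : g⁻¹ * k = 1 := by
      apply hbot
      intro i
      obtain ⟨-, n, hn, hnk⟩ := hk i
      rw [← hnk, ← mul_assoc, inv_mul_cancel, one_mul]
      exact hn
    have : k = g := by
      have := congrArg (fun y => g * y) hgk
      simpa using this
    rw [← this]
    exact hkK
  · intro k hk
    rw [Set.mem_iInter]
    intro i
    exact Set.mem_mul.mpr ⟨k, hk, 1, (N i).one_mem, mul_one k⟩

namespace ProfiniteSemiGraph

variable {𝒢 : ProfiniteSemiGraph.{u}}

/-- **The estrangement step, CONSUMER in a compact overgroup** (identification (I4′)): as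
`noFixedBranchPairSystem_of_isTotallyEstranged`, but the branch-level Remark 2.2.1 identification may take
values in any group `Q` receiving `π₁^temp` injectively (in print: the profinite completion `π̂₁(G)`), with
`ψ : Π_v → Q` injective. Conclusion: the hypothesis `hnobp` of `SemiGraph.hstar_of_noFixedBranchPairSystem`.
[cite: MochizukiSemiAnbd2006, Thm. 3.7(iii) p.41] -/
theorem noFixedBranchPairSystem_of_isTotallyEstranged' (h𝒢 : 𝒢.Thm37Hypotheses) (c : TemperedPiChart 𝒢)
    {J : Type v} [Preorder J] (level : J → SemiGraph.{u}) (levelAct : ∀ j, c.G →* Aut (level j))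
    (levelTrans : ∀ ⦃i j : J⦄, i ≤ j → (level j ⟶ level i))
    (stabBranchPair' : ∀ (j₀ : J) (w : ∀ i : {i : J // j₀ ≤ i}, (level i.1).Vertex)
      (β β' : ∀ i : {i : J // j₀ ≤ i}, (level i.1).Branch),
      (∀ i, β i ≠ β' i ∧ (level i.1).abuts (β i) = some (w i) ∧ (level i.1).abuts (β' i) = some (w i)) →
      (∀ ⦃i i' : {i : J // j₀ ≤ i}⦄ (h : i.1 ≤ i'.1), (levelTrans h).vertexMap (w i') = w i ∧
        (levelTrans h).branchMap (β i') = β i ∧ (levelTrans h).branchMap (β' i') = β' i) →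
      ∃ (Q : Type u) (_ : Group Q) (ιQ : c.G →* Q) (v : 𝒢.graph.Vertex) (b b' : 𝒢.graph.Branch)
        (hb : 𝒢.graph.abuts b = some v) (hb' : 𝒢.graph.abuts b' = some v) (ψ : 𝒢.Gv v →* Q) (x x' : 𝒢.Gv v),
        Function.Injective ιQ ∧ Function.Injective ψ ∧ (b' ≠ b ∨ x⁻¹ * x' ∉ 𝒢.branchSubgroup b v hb) ∧
        ∀ g : c.G, (∀ i, (levelAct i.1 g).hom.vertexMap (w i) = w i ∧
          (levelAct i.1 g).hom.branchMap (β i) = β i ∧ (levelAct i.1 g).hom.branchMap (β' i) = β' i) →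
          ιQ g ∈ ((𝒢.branchSubgroup b v hb).map (MulAut.conj x).toMonoidHom).map ψ ⊓
            ((𝒢.branchSubgroup b' v hb').map (MulAut.conj x').toMonoidHom).map ψ)
    (C : Subgroup c.G) :
    ∀ (j₀ : J) (w : ∀ i : {i : J // j₀ ≤ i}, (level i.1).Vertex)
      (β β' : ∀ i : {i : J // j₀ ≤ i}, (level i.1).Branch),
      (∀ i, β i ≠ β' i ∧ (level i.1).abuts (β i) = some (w i) ∧ (level i.1).abuts (β' i) = some (w i)) →
      (∀ ⦃i i' : {i : J // j₀ ≤ i}⦄ (h : i.1 ≤ i'.1), (levelTrans h).vertexMap (w i') = w i ∧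
        (levelTrans h).branchMap (β i') = β i ∧ (levelTrans h).branchMap (β' i') = β' i) →
      (∀ (i : {i : J // j₀ ≤ i}) (γ : C), (levelAct i.1 γ).hom.vertexMap (w i) = w i ∧
        (levelAct i.1 γ).hom.branchMap (β i) = β i ∧ (levelAct i.1 γ).hom.branchMap (β' i) = β' i) →
      C = ⊥ := by
  intro j₀ w β β' hpair hcompat hfix
  obtain ⟨Q, _, ιQ, v, b, b', hb, hb', ψ, x, x', hι, hψ, hne, hstab⟩ := stabBranchPair' j₀ w β β' hpair hcompat
  have hest := (h𝒢.isTotallyEstranged (𝒢.graph.edgeOf b)).2 b rfl v hb b' hb' (x⁻¹ * x') hne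
  have hbot := map_conj_inf_map_conj_eq_bot ψ hψ _ _ x x' hest
  rw [eq_bot_iff]
  intro g hg
  have hmem := hstab g fun i => hfix i ⟨g, hg⟩
  rw [hbot, Subgroup.mem_bot] at hmem
  exact hι (by rw [hmem, map_one])

end ProfiniteSemiGraph

end Literature.AnabelianGeometry.SemiGraphs
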